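import Mathlib
import HarnessLib
import HarnessLib.Audit
import Summits.AtomisticToContinuum.Statement
import Literature.MathematicalPhysics.StatisticalMechanics.LennardJonesClusters

/-!
Route: SphericalLevOlevskii

CLOSED (retired) 2026-08-15T13:46:45Z by operator:999:1257524 — reason: not-a-thesis: assembly does not conclude the sub-problem Statement — note: D-0027 §2.1 audit (human 2026-08-15: routes that do not decide the summit are removed): the assembly concludes `Literature.MathematicalPhysics.StatisticalMechanics.Crystallization`, not the sub-problem statement; a NEW conforming route may be opened from the same idea (generated `closes : … → _root_. The file is kept as the record of this route; refuted decls are indexed as negative knowledge (`ledger negatives`).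

# Route SphericalLevOlevskii — two-sided slackness of an exact certificate plus template-relative
diffraction rigidity gives Blanc–Lewin (ii) without kissing geometry

X = StrictCertificate ∧ DiffractionRigidity ("it suffices to show"). StrictCertificate (FUEL, shared
bet with route CrystalThreeCone,
item ExactCertificate): Lennard-Jones admits an EXACT zero-pressure split V_LJ = g + U + f on (0,∞)
at a periodic template P (g of finite
range and c-stable, U ≥ 0, f radial of positive type, c + f(0)/2 = −e(P)) which is moreover STRICT:
U is continuous and vanishes only on the
distance set D_P of P, and F = f∘‖·‖ is continuous, integrable, with integrable real Fourier
transform f̂ ≥ 0 vanishing off 0 only on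
spheres through the dual lattice of P. DiffractionRigidity (ENGINE, potential-free, the card's
"spherical Lev–Olevskii problem" posed
RELATIVE TO A PERIODIC TEMPLATE and in finite-N form): a sequence of N-point configurations with a
hard core whose pair distances at every
fixed range concentrate on D_P up to o(N) pairs (S2) and whose structure factor carries o(N) mass on
compact sets off {0} ∪ {Bragg spheres
of P} (S3) converges locally, along a subsequence and after translations, to a non-zero periodic
point measure. Realises card
diffraction-rigidity-spherical-lev-olevskii; consumes CrystalThreeCone's certificate items verbatim
(shared signatures).
Lean: `(∃ (P : Literature.MathematicalPhysics.StatisticalMechanics.PeriodicConfiguration 3) (ρ c :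
ℝ) (g U f : ℝ → ℝ), (∀ r : ℝ, 0 < r →
Literature.MathematicalPhysics.StatisticalMechanics.lennardJones r = g r + U r + f r) ∧ (∀ r : ℝ, 0
< r → 0 ≤ U r) ∧ (∀ r : ℝ, ρ ≤ r → g r = 0) ∧ (∀ (n : ℕ) (y : Fin n → EuclideanSpace ℝ (Fin 3)) (w :
Fin n → ℝ), 0 ≤ ∑ i, ∑ j, w i * w j * f (dist (y i) (y j))) ∧ (∀ (N : ℕ) (x : Fin N → EuclideanSpace
ℝ (Fin 3)), Function.Injective x → -(c * (N : ℝ)) ≤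
Literature.MathematicalPhysics.StatisticalMechanics.interactionEnergy g x) ∧ c + f 0 / 2 =
-(P.energyPerParticle Literature.MathematicalPhysics.StatisticalMechanics.lennardJones) ∧
ContinuousOn U (Set.Ioi 0) ∧ (∀ r : ℝ, 0 < r → U r = 0 → ∃ a ∈ P.points, ∃ b ∈ P.points, r = dist a
b) ∧ Continuous (fun v : EuclideanSpace ℝ (Fin 3) => (f ‖v‖ : ℂ)) ∧ MeasureTheory.Integrable (fun v
: EuclideanSpace ℝ (Fin 3) => (f ‖v‖ : ℂ)) ∧ MeasureTheory.Integrable (FourierTransform.fourier (fun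
v : EuclideanSpace ℝ (Fin 3) => (f ‖v‖ : ℂ))) ∧ (∀ ξ : EuclideanSpace ℝ (Fin 3),
(FourierTransform.fourier (fun v : EuclideanSpace ℝ (Fin 3) => (f ‖v‖ : ℂ)) ξ).im = 0 ∧ 0 ≤
(FourierTransform.fourier (fun v : EuclideanSpace ℝ (Fin 3) => (f ‖v‖ : ℂ)) ξ).re) ∧ (∀ ξ :
EuclideanSpace ℝ (Fin 3), ξ ≠ 0 → (∀ k : EuclideanSpace ℝ (Fin 3), (∀ g ∈ P.lattice, ∃ n : ℤ, inner
ℝ k g = (n : ℝ)) → ‖ξ‖ ≠ ‖k‖) → FourierTransform.fourier (fun v : EuclideanSpace ℝ (Fin 3) => (f ‖v‖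
: ℂ)) ξ ≠ 0)) ∧ (∀ (P : Literature.MathematicalPhysics.StatisticalMechanics.PeriodicConfiguration 3)
(δ : ℝ), 0 < δ → ∀ x : (N : ℕ) → (Fin N → EuclideanSpace ℝ (Fin 3)), (∀ (N : ℕ) (i j : Fin N), i ≠ j
→ δ ≤ dist (x N i) (x N j)) → (∀ R η : ℝ, 0 < η → Filter.Tendsto (fun N : ℕ => (Nat.card {p : Fin N
× Fin N // p.1 ≠ p.2 ∧ dist (x N p.1) (x N p.2) ≤ R ∧ ∀ a ∈ P.points, ∀ b ∈ P.points, η ≤ |dist (x N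
p.1) (x N p.2) - dist a b|} : ℝ) / N) Filter.atTop (nhds 0)) → (∀ h : EuclideanSpace ℝ (Fin 3) → ℝ,
Continuous h → HasCompactSupport h → (∀ ξ ∈ tsupport h, ξ ≠ 0 ∧ ∀ k : EuclideanSpace ℝ (Fin 3), (∀ g
∈ P.lattice, ∃ n : ℤ, inner ℝ k g = (n : ℝ)) → ‖ξ‖ ≠ ‖k‖) → Filter.Tendsto (fun N : ℕ => (∫ ξ, h ξ *
‖∑ j : Fin N, Complex.exp (2 * Real.pi * Complex.I * (inner ℝ ξ (x N j) : ℂ))‖ ^ 2) / N)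
Filter.atTop (nhds 0)) → ∃ (φ : ℕ → ℕ) (τ : ℕ → EuclideanSpace ℝ (Fin 3)) (Q :
Literature.MathematicalPhysics.StatisticalMechanics.PeriodicConfiguration 3) (m : EuclideanSpace ℝ
(Fin 3) → ℕ), StrictMono φ ∧ (∀ s ∈ Q.points, 1 ≤ m s) ∧ (∀ g ∈ Q.lattice, ∀ s, m (s + g) = m s) ∧ ∀
f : EuclideanSpace ℝ (Fin 3) → ℝ, Continuous f → HasCompactSupport f → Filter.Tendsto (fun j => ∑ i
: Fin (φ j), f (x (φ j) i + τ j)) Filter.atTop (nhds (∑' s : Q.points, (m s : ℝ) * f s)))`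

## Assembly
Pure plumbing (sorry-free `Assembly_provable` in Sketch.lean): StrictImpliesExact turns
StrictCertificate into ExactCertificate,
CertificateBound into KeplerBound, EnergeticHalf with TrialStateUpper into
HasPeriodicGroundStateEnergy lennardJones 3; SlacknessTransfer
fed with StrictCertificate, TrialStateUpper, the discharged Literature fact
LennardJonesMinimalDistance_holds and DiffractionRigidity gives
IsCrystallizing lennardJones 3; the pair is
Literature.MathematicalPhysics.StatisticalMechanics.Crystallization. CommensurateRigidity is not
an antecedent: it is the strict special case whose proof de-risks the rank-2 crux and whose
refutation kills the line.

Rationale: WHY THIS LINE. An exact certificate proves conjunct (i) and, read through complementary slackness on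
BOTH sides (CohnKumar2006 §9; TorquatoStillinger2008;
the f = φ case is Suto2006's "S(k) = 0 on supp φ̂ ⟺ ground state"), pins the pair distances of every
ground-state sequence to D_P (slack U)
and its structure factor to the Bragg spheres of P (slack f̂, via Σ_{i,j} F(x_i − x_j) = ∫ f̂ |Σ_j
e^{2πi ξ·x_j}|²); CrystalThreeCone and
CrystalKissingRigidity then re-enter discrete geometry (robust Fejes Tóth 0758, Hägg selection
0737/0670), whereas here conjunct (ii) is
a harmonic-analysis rigidity statement in the spirit of Lev–Olevskii (LevOlevskii2014 Thm 2:
uniformly discrete support and spectrum ⇒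
Dirac combs; LevOlevskii2017 Thm 2.5) — imported area: Fourier quasicrystals / mathematical
diffraction (BaakeFrettlohGrimm2007,
Meyer2016, KurasovSarnak2020, AlonEtAl2024). What is new relative to the card and to its refuter
audits: the rigidity is stated relative
to the certificate's periodic TEMPLATE, so every enemy must have template-valued distances —
pinwheel/quaquaversal order is excluded
arithmetically (BaakeFrettlohGrimm2007 §4.3 Claim 2: pinwheel distances √((p²+q²)/5^ℓ) with
unbounded ℓ, each of positive frequency),
fcc-type stacking letters are excluded by the fcc-only distance √8·a (8 ∉ D²_hcp ⊂ (1/3)ℕ), and in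
the commensurate case (D_P² ⊂ αℕ:
ideal hcp, fcc, ℤ³) Gram-matrix integrality confines local limits to ONE lattice, where periodicity
of the spectrum plus sphere support
forces a uniformly discrete, finitely generated rational frequency set and hence essential
periodicity — no kissing, Hales, η-robustness
or c/a bookkeeping. Negatives index: empty at filing.

RANKED CRUXES. #2 DiffractionRigidity (crux) — TEMPLATE-RELATIVE DIFFRACTION RIGIDITY (card item F3,
finite-N form). For every periodic configuration P of ℝ³ (lattice + finite motif), every δ > 0 and
every sequence x^N of N-point configurations with pairwise distances ≥ δ: if (S2) for every range R
and tolerance η > 0 the number of ordered pairs i ≠ j with |x_i − x_j| ≤ R whose distance is η-far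
from the distance set D_P = {|a − b| : a, b ∈ P} is o(N), and (S3) for every continuous compactly
supported h on frequency space whose support avoids 0 and every sphere {‖ξ‖ = ‖k‖}, k in the dual
lattice of P.lattice, one has (1/N)∫ h(ξ)|Σ_j e^{2πi⟨ξ,x_j⟩}|² dξ → 0, THEN there are a subsequence
N_j, translations τ_j, a periodic configuration Q and Q.lattice-periodic multiplicities m ≥ 1 on Q
such that Σ_i f(x_i^{N_j} + τ_j) → Σ_{s ∈ Q} m(s) f(s) for every continuous compactly supported f
(exactly the conclusion of IsCrystallizing). Existential Q absorbs homometric partners, polycrystals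
with growing grains and density-zero faults. [difficulty: XL] (why it might fail: Incommensurate
templates (relaxed LJ-hcp: c/a ≠ √(8/3), D_P² of rank 2) allow twisted/rational-rotation grain
structures with template-valued local distances; local limits then sit in a dense ℤ-module, γ is not
u.d.-supported (Kurasov–Sarnak/AKKV obstructions) leaving only "rods are not spheres".)
[LevOlevskii2014, LevOlevskii2017, BaakeFrettlohGrimm2007, AlonEtAl2024, KurasovSarnak2020,
GrimmBaake2008, ConwayRadin1998, Meyer2016, Meyer2022]
#3 StrictCertificate (crux) — STRICT EXACT CERTIFICATE FOR LENNARD-JONES (card item F4 + the card's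
design requirement). There are a periodic P, ρ, c and g, U, f : ℝ → ℝ with V_LJ = g + U + f on
(0,∞), U ≥ 0 on (0,∞), g ≡ 0 on [ρ,∞), f of positive type on ℝ³ as a radial function (finite
quadratic forms), g c-stable on all finite configurations of distinct points, c + f(0)/2 = −e(P)
[these six clauses are verbatim CrystalThreeCone.ExactCertificate, item 3100], AND: U continuous on
(0,∞) with U(r) = 0 ⇒ r ∈ D_P; F(v) = f(‖v‖) continuous and integrable on ℝ³ with integrable Fourier
transform 𝓕F, 𝓕F real and ≥ 0 everywhere, and 𝓕F(ξ) ≠ 0 whenever ξ ≠ 0 and ‖ξ‖ is not the norm of a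
dual-lattice vector of P.lattice (f̂ may vanish on extinct Bragg spheres). Expected P: relaxed hcp
at a* ≈ 0.9712. [difficulty: open-problem] (why it might fail: Shares CrystalThreeCone's open bet
(duality gap on the tail, Li2022 on the pure two-point ray; NoGap 3099 numerics pending) and adds
genericity: exactness may force extra zeros of U off D_P or of f̂ on a non-Bragg sphere, and f̂ ≥ 0
with f̂(0) = ∫F = 0 needs −∫|x|²F > 0 against the −r⁻⁶ tail.) [CohnKumar2006, CohnEtAl2019, Li2022,
Ruelle1969, TorquatoStillinger2008, Suto2006, BlancLewin2015]
#4 CommensurateRigidity (crux) — THE COMMENSURATE CASE (the card's "planar/ideal test", now the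
first theorem): DiffractionRigidity restricted to templates P whose squared distances lie in αℕ for
one α > 0 (ideal hcp with α = a²/3, fcc and ℤ³ with α = a²). Proof plan: (A) around all but o(N)
particles every pair in the R-ball is η_N-close to D_P with η_N → 0, so in any local limit Λ∞ ALL
squared distances lie in αℕ; Gram/frame integrality ⟨z − p₀, f_i⟩ ∈ (α/2)ℤ puts Λ∞ inside p₀ +
(α/2)M_F* — ONE lattice; (B) the autocorrelation γ of Λ∞ is supported on that lattice, so γ̂ is
periodic under its dual; periodic + carried by {0} ∪ spheres with radii² in a commensurate set ⇒
supp γ̂ lies in a lattice (uniformly discrete) ⇒ γ̂ = Σ_s a_s δ_{s + L*} over finitely many rational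
classes s ⇒ the autocorrelation coefficients form a finite non-negative trigonometric polynomial
attaining its maximum ν(0) = density on a finite-index sublattice L′ ⇒ Λ∞ is L′-periodic off a
density-zero set ⇒ arbitrarily large exact periodic windows ⇒ the conclusion (hard core +
approximate matching, CrystallizationLocalLimit in tree); (C) S3 passes to local limits around most
centres by the Plancherel identity ∫_t |𝓕(ψ_t μ_N)|² = |ψ̂|² ∗ |μ̂_N|² and lower semicontinuity of
intensities on open sets. [difficulty: L] (why it might fail: Degenerate or sparse local limits
(sheets scatter on rods, gases diffusely) must be excluded by S3 alone; the windowed transfer of S3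
and the l.s.c. step are unproved in this finite-N form; a coherent Σ-boundary network of bounded
spacing with all cross distances in D_P would stress step (B).) [LevOlevskii2014,
BaakeFrettlohGrimm2007, GrimmBaake2008, Radin1994, MoodyPostnikoffStrungaru2006, BlancLewin2015]
#9 ExactCertificate (support) — shared with CrystalThreeCone (item 3100, identical signature; a crux
there, the projection of StrictCertificate here): an exact three-cone certificate exists — P
periodic, ρ, c, g, U, f with V_LJ = g + U + f on (0,∞), U ≥ 0, g ≡ 0 on [ρ,∞), f of positive type, g
c-stable, c + f(0)/2 = −e(P). [difficulty: open-problem] [CohnKumar2006, Ruelle1969, Li2022]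
#9 KeplerBound (support) — shared with CrystalThreeCone (item 3102): some periodic P has N·e(P) ≤
E_N(x) for every N and every configuration of N distinct points (the optimal LJ stability constant
is a periodic energy per particle). [difficulty: open-problem] [BlancLewin2015, Ruelle1969]
#9 CertificateBound (support) — shared glue (CrystalThreeCone item 3103): an exact certificate gives
the Kepler bound — U-cone ≥ 0 termwise, Bochner form with w ≡ 1 gives 2Σ_{i<j} f ≥ −N f(0)
(two_mul_interactionEnergy_eq_sum_offDiag in tree), g-stability gives Σ_{i<j} g ≥ −cN; add.
[difficulty: provable-now] [Ruelle1969]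
#9 TrialStateUpper (support) — shared with CrystalThreeCone (item 3104): for every periodic Q and ε
> 0, eventually E(N)/N ≤ e(Q) + ε (finite blocks of Q as trial states; boundary O(N^{2/3}) particles
lose O(1) each by the summable r⁻⁶ tail, hasSum_lennardJones_dist_three in tree). [difficulty: M]
[BlancLewin2015]
#9 EnergeticHalf (support) — shared glue (CrystalThreeCone item 3105): KeplerBound + TrialStateUpper
⇒ conjunct (i) HasPeriodicGroundStateEnergy lennardJones 3 (e(P) ≤ E(N)/N by le_ciInf over the
non-empty injective configurations; TrialStateUpper at Q = P gives the limit, at general Q gives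
IsLeast). [difficulty: provable-now] [BlancLewin2015]
#9 StrictImpliesExact (support) — glue (projection; sorry-free in Sketch.lean): a strict certificate
is in particular an exact one — drop the last six conjuncts. [difficulty: provable-now] [Ruelle1969]
#9 SlacknessTransfer (support) — TWO-SIDED COMPLEMENTARY SLACKNESS (card items F1/F2/F5 in finite-N
form): StrictCertificate → TrialStateUpper → LennardJonesMinimalDistance → DiffractionRigidity →
IsCrystallizing lennardJones 3. Proof: for ground states x^N, E(N) − N e(P) = [E_g + cN] + [Σ_{i<j}
U(r_ij)] + ½[Σ_{i,j} F(x_i − x_j)] with three non-negative brackets, and TrialStateUpper at Q = P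
makes the left side ≤ εN eventually, so each bracket is o(N); hard core δ from
LennardJonesMinimalDistance (discharged in tree, δ = 1/3); U continuous and > 0 on the compact set
{r ∈ [δ,R] : dist(r, D_P) ≥ η} gives (S2); Fourier inversion for continuous integrable F with
integrable 𝓕F (Mathlib MeasureTheory.Integrable.fourierInv_fourier_eq) gives Σ_{i,j} F(x_i − x_j) =
∫ 𝓕F(ξ)|Σ_j e^{2πi⟨ξ,x_j⟩}|² dξ, and 𝓕F ≥ 0 everywhere, continuous and > 0 on tsupport h gives (S3);
DiffractionRigidity then returns exactly the conclusion of IsCrystallizing. [difficulty: M]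
[CohnKumar2006, TorquatoStillinger2008, Suto2006, BlancLewin2015]
#9 CommensurateOfGeneral (support) — glue (sorry-free in Sketch.lean): the commensurate case is a
special case of DiffractionRigidity; keeps the rank-4 crux honest as a strict weakening.
[difficulty: provable-now] [LevOlevskii2014]

TWO-LAYER PLAN. Foreseen glued splits (k ≤ 3, depth 1; nothing filed now). DiffractionRigidity ⇐
LatticeConfinement (hard core + S2 ⇒ around all but o(N)
particles the local limit lies in finitely many cosets of ONE lattice up to rotation; commensurate:
frame integrality; incommensurate: the
open part) → SpectralPeriodicity (lattice-confined + S3 ⇒ supp γ̂ uniformly discrete ⇒ finite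
rational frequency set ⇒ essentially periodic
⇒ the conclusion) → DiffractionRigidity. CommensurateRigidity ⇐ the same two children specialised
(WindowedTransfer: S3 localises to most
centres; CoherentCase: steps (A)+(B)). StrictCertificate ⇐ ExactCertificate (CrystalThreeCone's
LocalConstant → TailInterpolant) →
Strictification (perturb U and f inside their cones keeping exactness: U′ = U + εw, f′ = f − εw or
g′ = g − εw at an unwanted zero r* ∉ D_P,
using that P has no pairs at r*) → StrictCertificate.

KILL CRITERIA. CommensurateRigidity refuted (an aperiodic, non-polycrystalline hard-core sequence
with squared local distances in αℕ — e.g. all in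
(a²/3)ℕ — and sphere-supported structure factor with no crystalline local limit) closes the route
`refuted:CommensurateRigidity` (it
contains ideal hcp, fcc, ℤ³). DiffractionRigidity refuted only at an exotic incommensurate template
⇒ pivot (tenure): restate over templates
with D_P² ⊂ αℕ + βℕ² of hcp type, or add the local-tightness slack (S1) as a hypothesis.
StrictCertificate dies with CrystalThreeCone's NoGap
(item 3099: certified gap ≥ 1 % at ρ = 9/5 persisting at ρ = 2, 5/2) unless a hybrid certificate
with a strict positive-type component
survives (then re-fuel); a structural proof that every exact certificate has f̂ vanishing on a
non-Bragg sphere or U on an interval kills the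
strict form ⇒ close. 0627 refuted (route RefuteCrystalPeriodicMin) kills the conjunct and every
route with it.

NOT DECOMPOSED YET. The windowed-S3 transfer lemma and the lower-semicontinuity of intensities under
local limits; the finite-frequency {0,1}-sequence lemma
(a density-{0,1} sequence on a lattice whose autocorrelation is a finite trigonometric polynomial is
periodic off density zero); exclusion of
sheet-like/sparse local limits from S3; the incommensurate (rank-2 distance group, rank-6 module)
case and its "rods are not spheres"
argument; the design of f̂ near 0 (f̂(ξ) = a₂|ξ|² + O(|ξ|³), a₂ > 0) and which P (relaxed hcp, c/a)
— all layer-2, after CommensurateRigidity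
or NoGap moves. No point-process / autocorrelation-measure definitions are requested: everything is
stated through finite structure factors.

CHEAPEST FALSIFIER. (1) Lookup, DONE this session: is the pinwheel (the card's and refuter-12's test
case) a counterexample to the template-relative form? No —
BaakeFrettlohGrimm2007 §4.3 Claim 2–3 (read, p. 9): control points ⊂ (1/5^k)ℤ², distance set ⊂
{√((p²+q²)/5^ℓ)} with every ℓ occurring
and every distance of positive frequency, so (S2) fails at positive pair density against every
periodic template (bounded denominators);
Baake–Grimm 2013 §6.6 (read, pp. 222–223): FLC w.r.t. Euclidean motions only. (2) Kit job for a
refuter (finite): enumerate coincidence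
rotations Σ ≤ 49 of the hexagonal lattice A₂ × cℤ ∪ shifted cosets (ideal hcp) and test whether ANY
twist/tilt grain boundary has all
cross-boundary pair distances ≤ 3a inside D_hcp = √((1/3)ℕ)·a ∩ D_hcp-list; if one exists, stack it
aperiodically (Fibonacci spacing) and
compute the 1-D spectral measure along the normal — step (B) predicts Bragg heights dense on rods
(S3 violated); a sphere-supported outcome
refutes CommensurateRigidity. (3) Shared with CrystalThreeCone: the NoGap LP exploration (gap ≥ 1 %
files suspect-false on the fuel).

NUMBERS. Ideal hcp, nearest-neighbour a = 1: squared distances D²_hcp = {1, 2, 8/3, 3, 11/3, 4, 5,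
17/3, 6, 19/3, 20/3, 7, 22/3, 25/3, …} ⊂ (1/3)ℕ
(in-layer a²+ab+b²; adjacent layers (2+k)/3, k ∈ {1,4,7,13,16,19,25,28,31,37,…}; two apart 8/3 +
in-layer; three apart 6 + k/3).
fcc (ABC) adds (8+k)/3 two layers apart: 3, 4, 5, 7, 8, … — 8 and 20 are fcc distances² that are NOT
hcp distances² (first fcc/hcp
separator √8·a ≈ 2.83a > √(8/3)a, beyond ShortRangeStackingBlindness). Boerdijk–Coxeter helix:
d²(i,i+5) = 25/9 ∉ (1/3)ℕ; icosahedral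
shell edge 1.0515a ∉ D_hcp. Pinwheel: distances √((p²+q²)/5^ℓ), all ℓ (BaakeFrettlohGrimm2007 Claim
2–3), rotation angle arctan(1/2)
irrational mod 2π. Energetics (tree units V = r⁻¹²/12 − r⁻⁶/6, from
CrystalThreeCone/Stillinger2001): e(hcp) = −0.71759, e(fcc) =
−0.71752 (Δ ≈ 7e-5); a* = 0.9712; LJ ground-state minimal distance δ = 1/3
(LennardJonesMinimalDistance_holds). Relaxed LJ-hcp has c/a ≠
√(8/3) generically (no symmetry protects it; size uncertified here) — the reason DiffractionRigidity
is stated for ALL templates and the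
commensurate case separately. Items at open: 12 (3 cruxes, 8 support, 1 assembly).

DEFINITION REQUESTS. None. Dual lattice, Bragg spheres, distance set and structure factor are
inlined (∀ g ∈ P.lattice, ∃ n : ℤ, ⟪k,g⟫ = n; ‖Σ_j exp(2πi⟪ξ,x_j⟫)‖²;
{dist a b}); the tree's `Literature.Barriers.AtomisticToContinuum.Suto.dualLattice`-style API may be
used by provers but is not imported.
Mathlib supplies `FourierTransform.fourier` on EuclideanSpace ℝ (Fin 3) and
`MeasureTheory.Integrable.fourierInv_fourier_eq`.

Novelty: Searches (2026-08-15): `lit search --source zbmath "quasicrystals uniformly discrete support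
spectrum"` (8: LevOlevskii2014/2016/2017,
Favorov ×2, Meyer2022 curved model sets, Baake–Lenz spectral notions, Palamodov); zbmath "pinwheel
diffraction radial Poisson summation" (1:
BaakeFrettlohGrimm2007, READ §4.3); zbmath "homometric point sets diffraction uniqueness" (2:
GrimmBaake2008, Baake–Grimm 2006); zbmath
"higher dimensional Fourier quasicrystals Lee-Yang" (1: AlonEtAl2024 = Invent. 239 (2025), the
refuter-12 find, now cited); zbmath "measures
with locally finite support and spectrum" (Meyer2016 PNAS + RMI 2017, Guinand measures 2017); zbmath
"integral point sets embedding lattice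
rational distances" (0); `lit search --hybrid` local "uniformly discrete support spectrum Dirac comb
quasicrystal Poisson summation" (10 books;
Baake–Grimm 2013 held, §6.6 read); `lit galaxy search --star all` "Fourier quasicrystal" (3: CKMRV,
Fisher–Rabson Fourier-space
crystallography, Akiyama–Arnoux LNM 2273), "integral point sets" (6 problem books: Brass–Moser–Pach,
Guy, Klee–Wagon — Erdős-type integral
distances, unrelated to lattice confinement of Delone sets), "uniformly discrete spectrum" (0);
arXiv API 429 and galaxyd saturated
11:30Z (logged); plus the card's two refuter novelty audits (refuter-7, refuter-12: CohnKumar2006 §9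
/ CKMRV slackness, Lev–Olevskii,
AKKV, BFG07 all named there).
Nearest prior art found: LevOlevskii2014 (doi:10.1007/s00222-014-0542-z) Thm 2 — u.d. support + u.d.  [refs: 10.1007/s00222-014-0542-z, 1512.08735, doi:10.1007/s00222-014-0542-z, LevOlevskii2014, Meyer2022, BaakeFrettlohGrimm2007, GrimmBaake2008, AlonEtAl2024, Meyer2016, CohnKumar2006, LevOlevskii2017, TorquatoStillinger2008, Suto2006, KurasovSarnak2020]

Barriers (technique_class: complementary-slackness, diffraction-rigidity, lev-olevskii): - technique_class: complementary-slackness, diffraction-rigidity, lev-olevskii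
- Literature.Barriers.AtomisticToContinuum.KissingTwelveDegeneracy: evaded structurally — no contact
graph, shell or coordination number is read; a Barlow stacking with a positive density of c-letters
carries the fcc-only distance √8·a (8 ∉ D²_hcp) at positive pair density and is excluded by (S2)
once U is strict; zero-density-fault stackings satisfy the existential conclusion anyway
(AperiodicKissingTwelvePackings is consistent with the crux).
- Literature.Barriers.AtomisticToContinuum.ShortRangeStackingBlindness: consistent — the selecting
information sits at √8·a ≈ 2.83a > √(8/3)a (U-strictness) and in f̂'s weights on the distinguishing
reflections, i.e. beyond the blind range; the route needs CrystalThreeCone's split to be strict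
there (design requirement recorded in StrictCertificate).
- Literature.Barriers.AtomisticToContinuum.FlexibleKissingArrangements: not engaged — no
single-shell rigidity is claimed; the icosahedral shell (edge 1.0515a) and the Boerdijk–Coxeter
helix (25/9·a²) carry non-template distances at positive pair density and fail (S2).
- Literature.Barriers.AtomisticToContinuum.SutoDegenerateGroundStates: consistent and instructive —
for Sütő's φ the only certificate is f = φ with Z(f̂) ⊇ {‖k‖ ≥ K₀}, not a locally finite family of
spheres: StrictCertificate fails and the engine is never invoked, matching the continuum of GSCs
(unions of incommensurate bcc lattices); the bet is t

History (route lifecycle, newest last):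
- 2026-08-15T13:46:45Z · CLOSED retired — not-a-thesis: assembly does not conclude the sub-problem Statement (operator:999:1257524)

sub-problem: Crystallization · status: closed(retired) · opened planner-plancard-AtomisticToContinuum-Crystal-d6b0e32f-0 2026-08-15T11:49:44Z · rev 1 · ledger route-AtomisticToContinuum-SphericalLevOlevskii
GENERATED by the gate from the ledger (D-0016/17). Provers cite these decls: `theorem foo : Summit.AtomisticToContinuum.Crystallization.Theses.SphericalLevOlevskii.<Decl> := …` in Summits/AtomisticToContinuum/Crystallization/Theorems/<Name>.lean.
-/

namespace Summit.AtomisticToContinuum.Crystallization.Theses.SphericalLevOlevskii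

open scoped BigOperators Topology Manifold Classical MeasureTheory ProbabilityTheory Matrix InnerProductSpace ComplexConjugate ContinuousMap
open Filter Set Function TopologicalSpace MeasureTheory

attribute [summit_statement] _root_.Crystallization

/-- item stmt-AtomisticToContinuum-6657 · crux · rank 2 · closed · moot by None · by planner
why it might fail: Incommensurate templates (relaxed LJ-hcp: c/a ≠ √(8/3), D_P² of rank 2) allow twisted/rational-rotation grain structures with template-valued local distances; local limits then sit in a dense ℤ-module, γ is not u.d.-supported (Kurasov–Sarnak/AKKV obstructions) leaving only "rods are not spheres".
sources: LevOlevskii2014, LevOlevskii2017, BaakeFrettlohGrimm2007, AlonEtAl2024, KurasovSarnak2020, GrimmBaake2008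
[crux] TEMPLATE-RELATIVE DIFFRACTION RIGIDITY (card item F3, finite-N form). For every periodic
configuration P of ℝ³ (lattice + finite motif), every δ > 0 and every sequence x^N of N-point
configurations with pairwise distances ≥ δ: if (S2) for every range R and tolerance η > 0 the number
of ordered pairs i ≠ j with |x_i − x_j| ≤ R whose distance is η-far from the distance set D_P = {|a
− b| : a, b ∈ P} is o(N), and (S3) for every continuous compactly supported h on frequency space
whose support avoids 0 and every sphere {‖ξ‖ = ‖k‖}, k in the dual lattice of P.lattice, one has
(1/N)∫ h(ξ)|Σ_j e^{2πi⟨ξ,x_j⟩}|² dξ → 0, THEN there are a subsequence N_j, translations τ_j, a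
periodic configuration Q and Q.lattice-periodic multiplicities m ≥ 1 on Q such that Σ_i f(x_i^{N_j}
+ τ_j) → Σ_{s ∈ Q} m(s) f(s) for every continuous compactly supported f (exactly the conclusion of
IsCrystallizing). Existential Q absorbs homometric partners, polycrystals with growing grains and
density-zero faults. [difficulty: XL] -/
@[route_item "route-AtomisticToContinuum-SphericalLevOlevskii"]
def DiffractionRigidity : Prop :=
  ∀ (P : Literature.MathematicalPhysics.StatisticalMechanics.PeriodicConfiguration 3) (δ : ℝ), 0 < δ → ∀ x : (N : ℕ) → (Fin N → EuclideanSpace ℝ (Fin 3)), (∀ (N : ℕ) (i j : Fin N), i ≠ j → δ ≤ dist (x N i) (x N j)) → (∀ R η : ℝ, 0 < η → Filter.Tendsto (fun N : ℕ => (Nat.card {p : Fin N × Fin N // p.1 ≠ p.2 ∧ dist (x N p.1) (x N p.2) ≤ R ∧ ∀ a ∈ P.points, ∀ b ∈ P.points, η ≤ |dist (x N p.1) (x N p.2) - dist a b|} : ℝ) / N) Filter.atTop (nhds 0)) → (∀ h : EuclideanSpace ℝ (Fin 3) → ℝ, Continuous h → HasCompactSupport h → (∀ ξ ∈ tsupport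 h, ξ ≠ 0 ∧ ∀ k : EuclideanSpace ℝ (Fin 3), (∀ g ∈ P.lattice, ∃ n : ℤ, inner ℝ k g = (n : ℝ)) → ‖ξ‖ ≠ ‖k‖) → Filter.Tendsto (fun N : ℕ => (∫ ξ, h ξ * ‖∑ j : Fin N, Complex.exp (2 * Real.pi * Complex.I * (inner ℝ ξ (x N j) : ℂ))‖ ^ 2) / N) Filter.atTop (nhds 0)) → ∃ (φ : ℕ → ℕ) (τ : ℕ → EuclideanSpace ℝ (Fin 3)) (Q : Literature.MathematicalPhysics.StatisticalMechanics.PeriodicConfiguration 3) (m : EuclideanSpace ℝ (Fin 3) → ℕ), StrictMono φ ∧ (∀ s ∈ Q.points, 1 ≤ m s) ∧ (∀ g ∈ Q.lattice, ∀ s, m (s + g) = m s) ∧ ∀ f : EuclideanSpace ℝ (Fin 3) → ℝ, Continuous f → HasCompactSupport f → Filter.Tendsto (fun j => ∑ i : Fin (φ j), f (x (φ j) i + τ j)) Filter.atTop (nhds (∑' s : Q.points, (m s : ℝ) * f s))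

/-- item stmt-AtomisticToContinuum-6658 · crux · rank 3 · closed · moot by None · by planner
why it might fail: Shares CrystalThreeCone's open bet (duality gap on the tail, Li2022 on the pure two-point ray; NoGap 3099 numerics pending) and adds genericity: exactness may force extra zeros of U off D_P or of f̂ on a non-Bragg sphere, and f̂ ≥ 0 with f̂(0) = ∫F = 0 needs −∫|x|²F > 0 against the −r⁻⁶ tail.
sources: CohnKumar2006, CohnEtAl2019, Li2022, Ruelle1969, TorquatoStillinger2008, Suto2006
[crux] STRICT EXACT CERTIFICATE FOR LENNARD-JONES (card item F4 + the card's design requirement).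
There are a periodic P, ρ, c and g, U, f : ℝ → ℝ with V_LJ = g + U + f on (0,∞), U ≥ 0 on (0,∞), g ≡
0 on [ρ,∞), f of positive type on ℝ³ as a radial function (finite quadratic forms), g c-stable on
all finite configurations of distinct points, c + f(0)/2 = −e(P) [these six clauses are verbatim
CrystalThreeCone.ExactCertificate, item 3100], AND: U continuous on (0,∞) with U(r) = 0 ⇒ r ∈ D_P;
F(v) = f(‖v‖) continuous and integrable on ℝ³ with integrable Fourier transform 𝓕F, 𝓕F real and ≥ 0
everywhere, and 𝓕F(ξ) ≠ 0 whenever ξ ≠ 0 and ‖ξ‖ is not the norm of a dual-lattice vector of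
P.lattice (f̂ may vanish on extinct Bragg spheres). Expected P: relaxed hcp at a* ≈ 0.9712.
[difficulty: open-problem] -/
@[route_item "route-AtomisticToContinuum-SphericalLevOlevskii"]
def StrictCertificate : Prop :=
  ∃ (P : Literature.MathematicalPhysics.StatisticalMechanics.PeriodicConfiguration 3) (ρ c : ℝ) (g U f : ℝ → ℝ), (∀ r : ℝ, 0 < r → Literature.MathematicalPhysics.StatisticalMechanics.lennardJones r = g r + U r + f r) ∧ (∀ r : ℝ, 0 < r → 0 ≤ U r) ∧ (∀ r : ℝ, ρ ≤ r → g r = 0) ∧ (∀ (n : ℕ) (y : Fin n → EuclideanSpace ℝ (Fin 3)) (w : Fin n → ℝ), 0 ≤ ∑ i, ∑ j, w i * w j * f (dist (y i) (y j))) ∧ (∀ (N : ℕ) (x : Fin N → EuclideanSpace ℝ (Fin 3)), Function.Injective x → -(c * (N : ℝ)) ≤ Literature.MathematicalPhysics.StatisticalMechanics.interactionEnergy g x) ∧ c + f 0 / 2 = -(P.energyPerParticle Literature.MathematicalPhysics.StatisticalMechanics.lennardJones) ∧ ContinuousOn U (Set.Ioi 0) ∧ (∀ r : ℝ, 0 <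 r → U r = 0 → ∃ a ∈ P.points, ∃ b ∈ P.points, r = dist a b) ∧ Continuous (fun v : EuclideanSpace ℝ (Fin 3) => (f ‖v‖ : ℂ)) ∧ MeasureTheory.Integrable (fun v : EuclideanSpace ℝ (Fin 3) => (f ‖v‖ : ℂ)) ∧ MeasureTheory.Integrable (FourierTransform.fourier (fun v : EuclideanSpace ℝ (Fin 3) => (f ‖v‖ : ℂ))) ∧ (∀ ξ : EuclideanSpace ℝ (Fin 3), (FourierTransform.fourier (fun v : EuclideanSpace ℝ (Fin 3) => (f ‖v‖ : ℂ)) ξ).im = 0 ∧ 0 ≤ (FourierTransform.fourier (fun v : EuclideanSpace ℝ (Fin 3) => (f ‖v‖ : ℂ)) ξ).re) ∧ (∀ ξ : EuclideanSpace ℝ (Fin 3), ξ ≠ 0 → (∀ k : EuclideanSpace ℝ (Fin 3), (∀ g ∈ P.lattice, ∃ n : ℤ, inner ℝ k g = (n : ℝ)) → ‖ξ‖ ≠ ‖k‖) → FourierTransform.fourier (fun v : EuclideanSpace ℝ (Fin 3) => (f ‖v‖ : ℂ)) ξ ≠ 0)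

/-- item stmt-AtomisticToContinuum-6659 · crux · rank 4 · closed · moot by None · by planner
why it might fail: Degenerate or sparse local limits (sheets scatter on rods, gases diffusely) must be excluded by S3 alone; the windowed transfer of S3 and the l.s.c. step are unproved in this finite-N form; a coherent Σ-boundary network of bounded spacing with all cross distances in D_P would stress step (B).
sources: LevOlevskii2014, BaakeFrettlohGrimm2007, GrimmBaake2008, Radin1994, MoodyPostnikoffStrungaru2006, BlancLewin2015
[crux] THE COMMENSURATE CASE (the card's "planar/ideal test", now the first theorem):
DiffractionRigidity restricted to templates P whose squared distances lie in αℕ for one α > 0 (ideal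
hcp with α = a²/3, fcc and ℤ³ with α = a²). Proof plan: (A) around all but o(N) particles every pair
in the R-ball is η_N-close to D_P with η_N → 0, so in any local limit Λ∞ ALL squared distances lie
in αℕ; Gram/frame integrality ⟨z − p₀, f_i⟩ ∈ (α/2)ℤ puts Λ∞ inside p₀ + (α/2)M_F* — ONE lattice;
(B) the autocorrelation γ of Λ∞ is supported on that lattice, so γ̂ is periodic under its dual;
periodic + carried by {0} ∪ spheres with radii² in a commensurate set ⇒ supp γ̂ lies in a lattice
(uniformly discrete) ⇒ γ̂ = Σ_s a_s δ_{s + L*} over finitely many rational classes s ⇒ the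
autocorrelation coefficients form a finite non-negative trigonometric polynomial attaining its
maximum ν(0) = density on a finite-index sublattice L′ ⇒ Λ∞ is L′-periodic off a density-zero set ⇒
arbitrarily large exact periodic windows ⇒ the conclusion (hard core + approximate matching,
CrystallizationLocalLimit in tree); (C) S3 passes to local limits around most centres by the
Plancherel identity ∫_t |𝓕(ψ_t μ_N)|² = |ψ̂|² ∗ | -/
@[route_item "route-AtomisticToContinuum-SphericalLevOlevskii"]
def CommensurateRigidity : Prop :=
  ∀ (P : Literature.MathematicalPhysics.StatisticalMechanics.PeriodicConfiguration 3), (∃ α : ℝ, 0 < α ∧ ∀ a ∈ P.points, ∀ b ∈ P.points, ∃ n : ℕ, dist a b ^ 2 = α * n) → ∀ δ : ℝ, 0 < δ → ∀ x : (N : ℕ) → (Fin N → EuclideanSpace ℝ (Fin 3)), (∀ (N : ℕ) (i j : Fin N), i ≠ j → δ ≤ dist (x N i) (x N j)) → (∀ R η : ℝ, 0 < η → Filter.Tendsto (fun N : ℕ => (Nat.card {p : Fin N × Fin N // p.1 ≠ p.2 ∧ dist (x N p.1) (x N p.2) ≤ R ∧ ∀ a ∈ P.points, ∀ b ∈ P.points,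 η ≤ |dist (x N p.1) (x N p.2) - dist a b|} : ℝ) / N) Filter.atTop (nhds 0)) → (∀ h : EuclideanSpace ℝ (Fin 3) → ℝ, Continuous h → HasCompactSupport h → (∀ ξ ∈ tsupport h, ξ ≠ 0 ∧ ∀ k : EuclideanSpace ℝ (Fin 3), (∀ g ∈ P.lattice, ∃ n : ℤ, inner ℝ k g = (n : ℝ)) → ‖ξ‖ ≠ ‖k‖) → Filter.Tendsto (fun N : ℕ => (∫ ξ, h ξ * ‖∑ j : Fin N, Complex.exp (2 * Real.pi * Complex.I * (inner ℝ ξ (x N j) : ℂ))‖ ^ 2) / N) Filter.atTop (nhds 0)) → ∃ (φ : ℕ → ℕ) (τ : ℕ → EuclideanSpace ℝ (Fin 3)) (Q : Literature.MathematicalPhysics.StatisticalMechanics.PeriodicConfiguration 3) (m : EuclideanSpace ℝ (Fin 3) → ℕ), StrictMono φ ∧ (∀ s ∈ Q.points, 1 ≤ m s) ∧ (∀ g ∈ Q.lattice, ∀ s, m (s + g) = m s) ∧ ∀ f : EuclideanSpace ℝ (Fin 3) → ℝ, Continuous f → HasCompactSupport f → Filter.Tendsto (fun j => ∑ i : Fin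 (φ j), f (x (φ j) i + τ j)) Filter.atTop (nhds (∑' s : Q.points, (m s : ℝ) * f s))

/-- item stmt-AtomisticToContinuum-3100 · support · rank 9 · closed · moot by None · by planner
sources: CohnKumar2006, Ruelle1969, Li2022
[crux] the thesis X (card items C2 + C3 merged into one existence statement): an EXACT three-cone
certificate exists — P periodic, ρ < ∞, c, g, U, f with V_LJ = g + U + f on (0,∞), U ≥ 0, g ≡ 0 on
[ρ,∞), f of positive type, g c-stable, and c + f(0)/2 = −e(P). Finite ρ is the content: with ρ = ∞
(g = V_LJ, U = f = 0) the statement collapses to KeplerBound; at finite ρ it says the tail beyond ρ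
can be paid EXACTLY by Bochner + slack (Cohn–Kumar-type interpolation: f ≤ V on [ρ,∞) with equality
on D_P ∩ [ρ,∞), f̂ vanishing against P's structure factor on the Bragg set and at 0 — zero pressure
⇒ ∫f = 0), while hcp(a*) is simultaneously a ground state of the finite-range g, certified by a
one-centre inequality. [deps: NoGap] [difficulty: open-problem] -/
@[route_item "route-AtomisticToContinuum-SphericalLevOlevskii"]
def ExactCertificate : Prop :=
  ∃ (P : Literature.MathematicalPhysics.StatisticalMechanics.PeriodicConfiguration 3) (ρ c : ℝ) (g U f : ℝ → ℝ), (∀ r : ℝ, 0 < r → Literature.MathematicalPhysics.StatisticalMechanics.lennardJones r = g r + U r + f r) ∧ (∀ r : ℝ, 0 < r → 0 ≤ U r) ∧ (∀ r : ℝ, ρ ≤ r → g r = 0) ∧ (∀ (n : ℕ) (y : Fin n → EuclideanSpace ℝ (Fin 3)) (w : Fin n → ℝ), 0 ≤ ∑ i, ∑ j, w i * w j * f (dist (y i) (y j))) ∧ (∀ (N : ℕ) (x : Fin N → EuclideanSpace ℝ (Fin 3)), Function.Injective x → -(c * (N : ℝ)) ≤ Literature.MathematicalPhysics.StatisticalMechanics.interactionEnergy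 g x) ∧ c + f 0 / 2 = -(P.energyPerParticle Literature.MathematicalPhysics.StatisticalMechanics.lennardJones)

/-- item stmt-AtomisticToContinuum-3102 · support · rank 9 · closed · moot by None · by planner
sources: BlancLewin2015, Ruelle1969
[support] KEPLER BOUND FOR LENNARD-JONES (finite-N energetic statement, the certificate's output
stripped of g, U, f): some periodic P has N·e(P) ≤ E_N(x) for every N and every configuration x of N
distinct points — equivalently B_LJ = −e(P): the optimal stability constant is a periodic energy per
particle (expected 8.611 in ε-units = 0.7176 in tree units). A by-product other routes may want;
here it follows from ExactCertificate in ten lines (CertificateBound). [difficulty: open-problem] -/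
@[route_item "route-AtomisticToContinuum-SphericalLevOlevskii"]
def KeplerBound : Prop :=
  ∃ P : Literature.MathematicalPhysics.StatisticalMechanics.PeriodicConfiguration 3, ∀ (N : ℕ) (x : Fin N → EuclideanSpace ℝ (Fin 3)), Function.Injective x → (N : ℝ) * P.energyPerParticle Literature.MathematicalPhysics.StatisticalMechanics.lennardJones ≤ Literature.MathematicalPhysics.StatisticalMechanics.interactionEnergy Literature.MathematicalPhysics.StatisticalMechanics.lennardJones x

/-- item stmt-AtomisticToContinuum-3103 · support · rank 9 · closed · moot by None · by planner
sources: Ruelle1969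
[support] glue: an exact certificate gives the Kepler bound — U-cone ≥ 0 termwise, the Bochner form
with w ≡ 1 gives 2Σ_{i<j} f ≥ −N f(0) (diagonal = f(0); two_mul_interactionEnergy_eq_sum_offDiag in
tree), g-stability gives Σ_{i<j} g ≥ −cN; add and use c + f(0)/2 = −e(P). [difficulty: provable-now] -/
@[route_item "route-AtomisticToContinuum-SphericalLevOlevskii"]
def CertificateBound : Prop :=
  ExactCertificate → KeplerBound

/-- item stmt-AtomisticToContinuum-3104 · support · rank 9 · closed · moot by None · by planner
sources: BlancLewin2015
[support] TRIAL-STATE UPPER BOUND per periodic configuration: for every periodic Q and ε > 0,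
eventually E(N)/N ≤ e(Q) + ε (finite blocks of Q as N-point trial states: boundary O(N^{2/3})
particles lose O(1) each since site energies are bounded by the summable r⁻⁶ tail,
hasSum_lennardJones_dist_three in tree). Implies 0629 (limsup ≤ ⨅) by le_ciInf without any BddBelow
hypothesis. [difficulty: M] -/
@[route_item "route-AtomisticToContinuum-SphericalLevOlevskii"]
def TrialStateUpper : Prop :=
  ∀ (Q : Literature.MathematicalPhysics.StatisticalMechanics.PeriodicConfiguration 3) (ε : ℝ), 0 < ε → ∀ᶠ N : ℕ in Filter.atTop, Literature.MathematicalPhysics.StatisticalMechanics.groundStateEnergy Literature.MathematicalPhysics.StatisticalMechanics.lennardJones 3 N / N ≤ Q.energyPerParticle Literature.MathematicalPhysics.StatisticalMechanics.lennardJones + ε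

/-- item stmt-AtomisticToContinuum-3105 · support · rank 9 · closed · moot by None · by planner
sources: BlancLewin2015
[support] glue: KeplerBound + TrialStateUpper ⇒ conjunct (i): from N e(P) ≤ E_N(x) get e(P) ≤ E(N)/N
for N ≥ 1 (le_ciInf over the non-empty injective configurations, nonempty_injective_config in tree);
with TrialStateUpper at Q = P, E(N)/N → e(P); at general Q, e(P) ≤ e(Q) + ε for all ε, so P IsLeast.
[difficulty: provable-now] -/
@[route_item "route-AtomisticToContinuum-SphericalLevOlevskii"]
def EnergeticHalf : Prop :=
  KeplerBound → TrialStateUpper → Literature.MathematicalPhysics.StatisticalMechanics.HasPeriodicGroundStateEnergy Literature.MathematicalPhysics.StatisticalMechanics.lennardJones 3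

/-- item stmt-AtomisticToContinuum-6660 · support · rank 9 · closed · moot by None · by planner
sources: Ruelle1969
[support] glue (projection; sorry-free in Sketch.lean): a strict certificate is in particular an
exact one — drop the last six conjuncts. [difficulty: provable-now] -/
@[route_item "route-AtomisticToContinuum-SphericalLevOlevskii"]
def StrictImpliesExact : Prop :=
  StrictCertificate → ExactCertificate

/-- item stmt-AtomisticToContinuum-6661 · support · rank 9 · closed · moot by None · by planner
sources: CohnKumar2006, TorquatoStillinger2008, Suto2006, BlancLewin2015
[support] TWO-SIDED COMPLEMENTARY SLACKNESS (card items F1/F2/F5 in finite-N form):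
StrictCertificate → TrialStateUpper → LennardJonesMinimalDistance → DiffractionRigidity →
IsCrystallizing lennardJones 3. Proof: for ground states x^N, E(N) − N e(P) = [E_g + cN] + [Σ_{i<j}
U(r_ij)] + ½[Σ_{i,j} F(x_i − x_j)] with three non-negative brackets, and TrialStateUpper at Q = P
makes the left side ≤ εN eventually, so each bracket is o(N); hard core δ from
LennardJonesMinimalDistance (discharged in tree, δ = 1/3); U continuous and > 0 on the compact set
{r ∈ [δ,R] : dist(r, D_P) ≥ η} gives (S2); Fourier inversion for continuous integrable F with
integrable 𝓕F (Mathlib MeasureTheory.Integrable.fourierInv_fourier_eq) gives Σ_{i,j} F(x_i − x_j) =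
∫ 𝓕F(ξ)|Σ_j e^{2πi⟨ξ,x_j⟩}|² dξ, and 𝓕F ≥ 0 everywhere, continuous and > 0 on tsupport h gives (S3);
DiffractionRigidity then returns exactly the conclusion of IsCrystallizing. [difficulty: M] -/
@[route_item "route-AtomisticToContinuum-SphericalLevOlevskii"]
def SlacknessTransfer : Prop :=
  StrictCertificate → TrialStateUpper → Literature.MathematicalPhysics.StatisticalMechanics.LennardJonesMinimalDistance → DiffractionRigidity → Literature.MathematicalPhysics.StatisticalMechanics.IsCrystallizing Literature.MathematicalPhysics.StatisticalMechanics.lennardJones 3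

/-- item stmt-AtomisticToContinuum-6662 · support · rank 9 · closed · moot by None · by planner
sources: LevOlevskii2014
[support] glue (sorry-free in Sketch.lean): the commensurate case is a special case of
DiffractionRigidity; keeps the rank-4 crux honest as a strict weakening. [difficulty: provable-now] -/
@[route_item "route-AtomisticToContinuum-SphericalLevOlevskii"]
def CommensurateOfGeneral : Prop :=
  DiffractionRigidity → CommensurateRigidity

/-- item stmt-AtomisticToContinuum-6663 · assembly · rank 1 · closed · moot by None · by planner
sources: BlancLewin2015, CohnKumar2006, LevOlevskii2014
[assembly] StrictCertificate → DiffractionRigidity → StrictImpliesExact → CertificateBound →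
EnergeticHalf → TrialStateUpper → SlacknessTransfer → Crystallization. -/
@[route_item "route-AtomisticToContinuum-SphericalLevOlevskii"]
def Assembly : Prop :=
  StrictCertificate → DiffractionRigidity → StrictImpliesExact → CertificateBound → EnergeticHalf → TrialStateUpper → SlacknessTransfer → Literature.MathematicalPhysics.StatisticalMechanics.Crystallization

end Summit.AtomisticToContinuum.Crystallization.Theses.SphericalLevOlevskii
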